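import Literature.Probability.Percolation.QuadCrossingContinuityCaseTwoSmall
import HarnessLib

/-!
# Schramm–Smirnov Lemma 6.1, case (3), sub-case `d₁ ≤ ρ`: thin quads, general topological quads

Topic `Probability/Percolation`; proofs file towards the named fact `SchrammSmirnov2011_lemma_6_1`
(`QuadCrossingContinuity.lean`; O. Schramm, S. Smirnov, *On the scaling limits of planar
percolation*, Ann. Probab. 39 (2011) 1768–1814, arXiv:1101.5820, Lemma 6.1 and its proof, p. 22:
"Case (ii): `d = d₀ > 4δ`. Observe that by duality the existence of an open crossing between
`{β}` and `∂₂Q` is equivalent to the absence of a dual closed crossing from `∂₁Q` to `∂₃Q` … By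
Russo–Seymour–Welsh estimates we conclude that (6.3) `P(⊞_{Q'}) ≤ C(4δ/d)^K`", and p. 23: "the
proof in case (3) is symmetric to that of case (2)").

Under condition (3) (`Quad.IsPerturbationThree`: `[Q'] ⊆ [Q]`, `∂₀Q' ⊆ ∂₀Q`, `∂₁Q' = ∂₁Q`,
`∂₂Q' ⊆ ∂₂Q`, points of `∂₃Q'` joined to `∂₃Q` by short paths) one has `⊞_{Q'} ⊆ ⊞_Q`
(`Quad.IsCrossing.of_subquad`), so `⊞_Q Δ ⊞_{Q'} ⊆ ⊞_Q`.  When `d₁(Q) ≤ ρ` the big quad itself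
is thin: a transversal `τ` from `∂₁Q` to `∂₃Q` of diameter `< 2ρ` exists, every crossing of `Q`
meets it and has diameter `≥ d₀(Q)`, hence crosses the annulus `A(x₁; 3ρ + δ', d₀/16 - δ')` about
the foot `x₁` of `τ` by open edges (`Quad.mem_annulusOpenCrossing_of_isCrossing_inner` applied to
the pair `(Q, Q)`); RSW bounds the probability by `(C ρ / d₀(Q))^α`
(`real_symmDiff_crossedEvent_le_of_isPerturbationThree_of_sideDist_one_le`).  Together with
`QuadCrossingContinuityCaseThreeSmall.lean` (`d₀(Q) ≤ ρ`) this settles case (3) for all quads with a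
thin direction; the remaining regime of case (3) needs the dual twin of the lowest-crossing
exploration.  Everything is proved; no named fact is introduced.

## References

* O. Schramm, S. Smirnov, Ann. Probab. 39 (2011) 1768–1814, arXiv:1101.5820, Lemma 6.1 and its
  proof, (ii) eq. (6.3) and case (3). [SchrammSmirnov2011]
-/

noncomputable section

open Set Metric Filter Function
open _root_.MeasureTheory _root_.Topology
open scoped ENNReal symmDiff
open Literature.Probability.LatticeModels
open Literature.Topology.PlaneTopology

namespace Literature.Probability.Percolation

namespace QuadCrossing

variable {D : Set ℂ}

/-- A quad is a (trivial) perturbation of type (2) of itself: the short junctions are constant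
paths. [folklore] -/
theorem Quad.shortJoin_self (Q : Quad D) {ρ : ℝ} (hρ : 0 ≤ ρ) :
    ∀ y ∈ Q.side 2, Q.ShortJoin ρ y (Q.side 2) := fun y hy =>
  ⟨y, hy, Path.refl y, by
    rintro _ ⟨t, rfl⟩
    exact Q.side_subset_carrier 2 hy, by
    have : range (Path.refl y) = {y} := by
      ext z; simp [eq_comm]
    rw [this, Metric.diam_singleton]; exact hρ⟩

/-- **Lemma 6.1, case (3), sub-case `d₁ ≤ ρ`**, for critical bond percolation on `δℤ²` and
general topological quads: there are `α, C, c > 0` such that whenever `Q.IsPerturbationThree Q' ρ`,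
`0 < ρ ≤ c · d₀(Q)` and `d₁(Q) ≤ ρ`, then for every mesh `0 < η < ρ`,
`μ_η(⊞_Q Δ ⊞_{Q'}) ≤ (C ρ / d₀(Q))^α`.  Proof: `⊞_{Q'} ⊆ ⊞_Q`; a crossing of `Q` crosses the
annulus `A(x₁; 3ρ + δ', d₀/16 - δ')` around the foot `x₁` of a transversal of `Q` of diameter
`< 2ρ` by open edges (`δ' = η√2`); RSW.
[cite: SchrammSmirnov2011, proof of Lemma 6.1, (ii) eq. (6.3) and case (3)] -/
theorem real_symmDiff_crossedEvent_le_of_isPerturbationThree_of_sideDist_one_le :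
    ∃ α C c : ℝ, 0 < α ∧ 0 < C ∧ 0 < c ∧
      ∀ (D : Set ℂ) (Q Q' : Quad D) (ρ : ℝ), 0 < ρ → ρ ≤ c * Q.sideDist 0 →
        Q.IsPerturbationThree Q' ρ → Q.sideDist 1 ≤ ρ →
          ∀ η : ℝ, 0 < η → η < ρ →
            (squareCrossingLaw D η : Measure (QuadConfig D)).real
                (symmDiff (QuadConfig.crossedEvent Q) (QuadConfig.crossedEvent Q')) ≤
              (C * ρ / Q.sideDist 0) ^ α := by
  obtain ⟨α, c₀, hα, hc₀, hRSW⟩ := annulusOpenCrossing_half_le_holds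
  set C₁ : ℝ := 5 + 2 * c₀ with hC₁
  have hC₁pos : 0 < C₁ := by rw [hC₁]; linarith
  refine ⟨α, 32 * C₁, 1 / (32 * (C₁ + 1)), hα, by positivity, by positivity, ?_⟩
  intro D Q Q' ρ hρ hρc h3 hd1 η hη hηρ
  obtain ⟨hcar, h0, h1, h2, -⟩ := h3
  set d₀ := Q.sideDist 0 with hd₀
  have hd₀pos : 0 < d₀ := Q.sideDist_pos 0
  -- the regime: `ρ ≤ d₀ / (32 (C₁ + 1))`
  have hρd : 32 * (C₁ + 1) * ρ ≤ d₀ := by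
    have := hρc
    rw [div_mul_eq_mul_div, one_mul, le_div_iff₀ (by positivity)] at this
    linarith
  have hc₀ρ : 0 ≤ c₀ * ρ := by positivity
  have hρ32 : 32 * ρ ≤ d₀ := by nlinarith
  -- the mesh `δ' = η √2 < 2ρ`
  set δ' : ℝ := η * Real.sqrt 2 with hδ'
  have hδ'pos : 0 < δ' := mul_pos hη (Real.sqrt_pos.2 (by norm_num))
  have hsqrt2 : Real.sqrt 2 < 2 := by
    rw [show (2 : ℝ) = Real.sqrt 4 by rw [show (4 : ℝ) = 2 ^ 2 by norm_num, Real.sqrt_sq (by norm_num)]]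
    exact Real.sqrt_lt_sqrt (by norm_num) (by norm_num)
  have hδ'ρ : δ' < 2 * ρ := by
    calc δ' = η * Real.sqrt 2 := rfl
      _ < ρ * 2 := mul_lt_mul'' hηρ hsqrt2 hη.le (Real.sqrt_nonneg _)
      _ = 2 * ρ := by ring
  -- Step 1: the law is bounded by the `P_{1/2}`-probability of the symmetric difference
  refine (real_squareCrossingLaw_symmDiff_le D η Q Q').trans ?_
  -- Step 2: the discrete events; `⊞_{Q'} ⊆ ⊞_Q`, so the symmetric difference is inside `⊞_Q`
  set A : Set (BondConfig (Site 2)) := {ω | Q ∈ z2QuadConfig D δ' ω} with hA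
  set B : Set (BondConfig (Site 2)) := {ω | Q' ∈ z2QuadConfig D δ' ω} with hB
  have hBA : B ⊆ A := fun ω hω => by
    rw [hB, mem_setOf_eq, mem_z2QuadConfig_iff_exists_isCrossing hδ'pos] at hω
    obtain ⟨K, hK, hKO⟩ := hω
    rw [hA, mem_setOf_eq, mem_z2QuadConfig_iff_exists_isCrossing hδ'pos]
    exact ⟨K, Quad.IsCrossing.of_subquad hcar h0 h2 hK, hKO⟩
  have hsymm : symmDiff A B ⊆ A := by
    intro ω hω
    rcases (Set.mem_symmDiff).1 hω with ⟨hωA, -⟩ | ⟨hωB, -⟩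
    · exact hωA
    · exact hBA hωB
  -- Step 3: a crossing of `Q` crosses an annulus around the foot of a short transversal of `Q`
  obtain ⟨x₁, hx₁, x₃, hx₃, τ, hτ, hτdiam⟩ := Q.exists_transversal_diam_lt
  have hD₁ : Metric.diam (range τ) ≤ 2 * ρ := by linarith
  set R : ℝ := d₀ / 16 with hR
  have hDR : 2 * ρ + ρ < R := by rw [hR]; linarith
  have hR2 : 2 * R < Q.sideDist 0 - ρ := by rw [hR]; linarith
  set r'' : ℝ := max (2 * ρ + ρ + δ') (c₀ * δ') with hr''
  have hAE : A ⊆ annulusOpenCrossing x₁ δ' r'' (R - δ') := fun ω hω => by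
    rw [hA, mem_setOf_eq, mem_z2QuadConfig_iff_exists_isCrossing hδ'pos] at hω
    obtain ⟨K, hK, hKO⟩ := hω
    exact annulusOpenCrossing_mono_left x₁ δ' (le_max_left _ _) _
      (Quad.mem_annulusOpenCrossing_of_isCrossing_inner hδ'pos hρ.le subset_rfl rfl
        (Q.shortJoin_self hρ.le) hx₁ hx₃ τ hτ hD₁ hDR hR2 hK hKO)
  -- Step 4: RSW
  have hr''δ : c₀ * δ' ≤ r'' := le_max_right _ _
  have hc₀δ : c₀ * δ' ≤ c₀ * (2 * ρ) := mul_le_mul_of_nonneg_left hδ'ρ.le hc₀.le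
  have hr''le : r'' ≤ C₁ * ρ := by
    rw [hr'', max_le_iff, hC₁]
    constructor
    · linarith
    · linarith
  have hR'ge : d₀ / 32 ≤ R - δ' := by rw [hR]; linarith
  have h2r : 2 * r'' ≤ R - δ' := by rw [hR]; linarith
  have hRSW' := hRSW x₁ δ' r'' (R - δ') hδ'pos hr''δ h2r
  -- Step 5: assemble
  have hmono : (bondPercolation (zdGraph 2) half).real (symmDiff A B) ≤
      (bondPercolation (zdGraph 2) half).real (annulusOpenCrossing x₁ δ' r'' (R - δ')) :=
    measureReal_mono (hsymm.trans hAE) (measure_ne_top _ _)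
  refine hmono.trans (hRSW'.trans ?_)
  -- `(r''/(R - δ'))^α ≤ (32 C₁ ρ / d₀)^α`
  have hbase : r'' / (R - δ') ≤ 32 * C₁ * ρ / d₀ := by
    rw [div_le_div_iff₀ (by linarith) hd₀pos]
    calc r'' * d₀ ≤ C₁ * ρ * d₀ := mul_le_mul_of_nonneg_right hr''le hd₀pos.le
      _ = 32 * C₁ * ρ * (d₀ / 32) := by ring
      _ ≤ 32 * C₁ * ρ * (R - δ') := by
          apply mul_le_mul_of_nonneg_left hR'ge; positivity
  have hr''nn : 0 ≤ r'' / (R - δ') := div_nonneg (le_trans (by positivity) hr''δ) (by linarith)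
  exact Real.rpow_le_rpow hr''nn hbase hα.le

end QuadCrossing

end Literature.Probability.Percolation
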